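import Summits.NavierStokesRegularity.NavierStokesRegularity.Theorems.ArgmaxDoorsDepletion
import Summits.NavierStokesRegularity.NavierStokesRegularity.Theorems.ArgmaxDoorsDepletionBounds
import HarnessLib

/-!
# ArgmaxDoorsDepletionLocal — door family S35 «ArgmaxDoors»: point depletion LOCALISED to a ball + L² tail

S-door lane tools (ns-sfl-p1 g5, sibling of `ArgmaxDoorsDepletion` p646609; LEAD ns-s30-p1 g3's TECHNICAL NOTE FOR
ROUND-34 2026-08-28T16:11:15Z «doors S35-C/A localise to a ball around the argmax at zero cost; the far field is paid
by the energy inequality», plate D♭; `--supports stmt-NavierStokesRegularity-0056 --as helper`). Text-independent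
(no door text inside):

* `inner_fderiv_le_local_add_tail` — for `v ∈ C²` with `v = K ∗ curl v`, `∫‖curl v‖² < ∞`, a unit `e` with
  `curl v(x₀) ∥ e`, the depletion integrand integrable, and EVERY `R > 0`:
  `⟪e, ∇v(x₀) e⟫ ≤ A·∫_{B(x₀,2R)} ‖ω(y) − ⟪ω(y),e⟩e‖|x₀−y|⁻³ dy + 8A'·∫_{|x₀−y| ≥ R} ‖ω(y)‖|x₀−y|⁻³ dy`
  (same split as `inner_fderiv_le_add_tail`, but the cut-off `χ_R` is KEPT in the depleted majorant:
  `A χ_R G ≤ A 1_{B(x₀,2R)} G`);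
* `inner_stretching_le_local` — in the frame: with the universal constants `A` (depletion) and `A'` (kernel
  gradient), for every classical unforced solution, `t ∈ [0,T)`, `x` with `ω(x,t) ≠ 0` and `R > 0`,
  `⟪ω,(∇u)ω⟫(x,t) ≤ |ω(x,t)|²·(A ∫_{B(x,2R)} G + 8A'·(4π/(3R³))^{1/2}·(∫‖ω(t)‖²)^{1/2})`
  (`integral_norm_mul_farCube_le`): the near field is charged to local coherence, the far field to the enstrophy.

WHAT THIS IS NOT: tools for regularity CRITERIA (doors S35-C / a localised C♭) about hypothetical blow-up; item 0056
`NoTypeII` and NS regularity are NOT proved; nothing here is a route or a summit statement.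
-/

-- the summit's problem namespace repeats the summit name (tree layout)
set_option linter.dupNamespace false

noncomputable section

open MeasureTheory Set Function Filter Metric Real InnerProductSpace
open scoped ENNReal NNReal RealInnerProductSpace Topology ContDiff

namespace Summit.NavierStokesRegularity.NavierStokesRegularity.Theorems.ArgmaxDoors

open Literature.Analysis.FluidPDE

/-! ### One truncation radius, cut-off kept in the majorant -/

/-- **Point depletion, localised.** As `inner_fderiv_le_add_tail`, with the near part charged to the BALL
`B(x₀, 2R)` only: `⟪e, ∇v(x₀) e⟫ ≤ A ∫_{B(x₀,2R)} ‖ω(y) − ⟪ω(y),e⟫e‖ |x₀−y|⁻³ dy + 8A' ∫_{|x₀−y| ≥ R} ‖ω(y)‖ |x₀−y|⁻³ dy`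
for every `R > 0` (the cut-off `χ_R = suppCutoff x₀ R` is `≤ 1_{B(x₀,2R)}` and stays inside the depleted majorant). -/
theorem inner_fderiv_le_local_add_tail {A : ℝ} (hA : 0 ≤ A)
    (hdep : ∀ ⦃γ C : ℝ≥0⦄ (_ : 0 < γ)
      ⦃f : (EuclideanSpace ℝ (Fin 3)) → (EuclideanSpace ℝ (Fin 3))⦄ (_ : HolderWith C γ f)
      (_ : HasCompactSupport f) ⦃x e : (EuclideanSpace ℝ (Fin 3))⦄ (_ : ‖e‖ = 1) (_ : ∃ c : ℝ, f x = c • e)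
      ⦃g : (EuclideanSpace ℝ (Fin 3)) → ℝ⦄ (_ : Integrable g)
      (_ : ∀ y, y ≠ x → A * ‖f y - ⟪f y, e⟫ • e‖ * (‖x - y‖ ^ 3)⁻¹ ≤ g y),
      |⟪e, fderiv ℝ (biotSavart f) x e⟫| ≤ ∫ y, g y)
    {A' : ℝ} (hK : IsC1SingularKernel biotSavartCLM A')
    {v : EuclideanSpace ℝ (Fin 3) → EuclideanSpace ℝ (Fin 3)} (hv : ContDiff ℝ 2 v)
    (hrep : biotSavart (curl v) = v) (hw2 : Integrable fun y => ‖curl v y‖ ^ 2)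
    {x₀ e : EuclideanSpace ℝ (Fin 3)} (he : ‖e‖ = 1) (hpar : curl v x₀ = ‖curl v x₀‖ • e)
    (hG : Integrable fun y => ‖curl v y - ⟪curl v y, e⟫ • e‖ * (‖x₀ - y‖ ^ 3)⁻¹)
    {R : ℝ} (hR : 0 < R) :
    ⟪e, fderiv ℝ v x₀ e⟫ ≤
      A * (∫ y in ball x₀ (2 * R), ‖curl v y - ⟪curl v y, e⟫ • e‖ * (‖x₀ - y‖ ^ 3)⁻¹) +
      8 * A' * ∫ y, ‖curl v y‖ *
        (ball (0 : EuclideanSpace ℝ (Fin 3)) R)ᶜ.indicator (fun z => (‖z‖ ^ 3)⁻¹) (x₀ - y) := by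
  have hA' : 0 ≤ A' := hK.nonneg
  have hw1 : ContDiff ℝ 1 (curl v) := contDiff_curl (n := 1) (by exact hv)
  have hwc : Continuous (curl v) := hw1.continuous
  have hχ : ContDiff ℝ 1 (suppCutoff x₀ R) := contDiff_suppCutoff x₀ R
  have hχc : HasCompactSupport (suppCutoff x₀ R) := hasCompactSupport_suppCutoff x₀ hR
  -- near part `f = χ ω` and far part `h = (1 − χ) ω` as genuine variables
  obtain ⟨f, hf_def⟩ : ∃ f : EuclideanSpace ℝ (Fin 3) → EuclideanSpace ℝ (Fin 3),
      f = fun y => suppCutoff x₀ R y • curl v y := ⟨_, rfl⟩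
  obtain ⟨h, hh_def⟩ : ∃ h : EuclideanSpace ℝ (Fin 3) → EuclideanSpace ℝ (Fin 3),
      h = fun y => (1 - suppCutoff x₀ R y) • curl v y := ⟨_, rfl⟩
  have hfh : ∀ y, f y + h y = curl v y := by
    intro y
    rw [hf_def, hh_def]
    simp only
    rw [← add_smul, add_sub_cancel, one_smul]
  have hf1 : ContDiff ℝ 1 f := by rw [hf_def]; exact hχ.smul hw1
  have hfc : HasCompactSupport f := by rw [hf_def]; exact hχc.smul_right
  have hfcont : Continuous f := hf1.continuous
  obtain ⟨C, hC⟩ := hf1.lipschitzWith_of_hasCompactSupport hfc one_ne_zero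
  have hHolder : HolderWith C 1 f := hC.holderWith
  -- `f(x₀) = ω(x₀)` is parallel to `e`
  have hχx₀ : suppCutoff x₀ R x₀ = 1 := suppCutoff_eq_one hR (by rw [sub_self, norm_zero]; exact hR.le)
  have hfx : ∃ c : ℝ, f x₀ = c • e := ⟨‖curl v x₀‖, by rw [hf_def]; simp only; rw [hχx₀, one_smul, ← hpar]⟩
  -- the LOCAL majorant `A χ G` (equality) and its integral `≤ A ∫_{B(x₀,2R)} G`
  have hχG : Integrable fun y => suppCutoff x₀ R y *
      (‖curl v y - ⟪curl v y, e⟫ • e‖ * (‖x₀ - y‖ ^ 3)⁻¹) :=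
    hG.bdd_mul (hχ.continuous.aestronglyMeasurable)
      (Eventually.of_forall fun y => by
        rw [Real.norm_eq_abs]; exact abs_suppCutoff_le_one x₀ R y)
  have hdom : ∀ y, y ≠ x₀ → A * ‖f y - ⟪f y, e⟫ • e‖ * (‖x₀ - y‖ ^ 3)⁻¹ ≤
      A * (suppCutoff x₀ R y * (‖curl v y - ⟪curl v y, e⟫ • e‖ * (‖x₀ - y‖ ^ 3)⁻¹)) := by
    intro y _
    have h1 : f y - ⟪f y, e⟫ • e = suppCutoff x₀ R y • (curl v y - ⟪curl v y, e⟫ • e) := by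
      rw [hf_def]
      simp only
      rw [real_inner_smul_left, smul_sub, mul_smul]
    rw [h1, norm_smul, Real.norm_eq_abs, abs_of_nonneg (suppCutoff_nonneg x₀ R y)]
    exact le_of_eq (by ring)
  have hball : ∫ y, suppCutoff x₀ R y * (‖curl v y - ⟪curl v y, e⟫ • e‖ * (‖x₀ - y‖ ^ 3)⁻¹) ≤
      ∫ y in ball x₀ (2 * R), ‖curl v y - ⟪curl v y, e⟫ • e‖ * (‖x₀ - y‖ ^ 3)⁻¹ := by
    rw [← integral_indicator measurableSet_ball]
    refine integral_mono_of_nonneg (Eventually.of_forall fun y => ?_) (hG.indicator measurableSet_ball)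
      (Eventually.of_forall fun y => ?_)
    · exact mul_nonneg (suppCutoff_nonneg x₀ R y) (by positivity)
    · by_cases hy : y ∈ ball x₀ (2 * R)
      · rw [indicator_of_mem hy]
        exact mul_le_of_le_one_left (by positivity) (suppCutoff_le_one x₀ R y)
      · rw [indicator_of_notMem hy]
        have hy' : 2 * R ≤ ‖y - x₀‖ := by
          rw [mem_ball, dist_eq_norm, not_lt] at hy; exact hy
        show suppCutoff x₀ R y * (‖curl v y - ⟪curl v y, e⟫ • e‖ * (‖x₀ - y‖ ^ 3)⁻¹) ≤ 0
        rw [suppCutoff_eq_zero hR hy', zero_mul]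
  have hnear : |⟪e, fderiv ℝ (biotSavart f) x₀ e⟫| ≤
      A * ∫ y in ball x₀ (2 * R), ‖curl v y - ⟪curl v y, e⟫ • e‖ * (‖x₀ - y‖ ^ 3)⁻¹ := by
    have h1 := hdep one_pos hHolder hfc he hfx (hχG.const_mul A) hdom
    rw [integral_const_mul] at h1
    exact h1.trans (mul_le_mul_of_nonneg_left hball hA)
  -- the far part
  have hhc : Continuous h := by
    rw [hh_def]; exact (continuous_const.sub hχ.continuous).smul hwc
  have hhle : ∀ y, ‖h y‖ ≤ ‖curl v y‖ := by
    intro y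
    rw [hh_def]
    simp only
    rw [norm_smul, Real.norm_eq_abs]
    have h01 : |1 - suppCutoff x₀ R y| ≤ 1 := by
      rw [abs_le]
      constructor <;> linarith [suppCutoff_nonneg x₀ R y, suppCutoff_le_one x₀ R y]
    exact mul_le_of_le_one_left (norm_nonneg _) h01
  have hh2 : Integrable fun y => ‖h y‖ ^ 2 := by
    refine hw2.mono' ((hhc.norm.pow 2).aestronglyMeasurable) (Eventually.of_forall fun y => ?_)
    rw [Real.norm_of_nonneg (sq_nonneg _)]
    exact pow_le_pow_left₀ (norm_nonneg _) (hhle y) 2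
  have hvan : ∀ y, ‖y - x₀‖ < R → h y = 0 := by
    intro y hy
    rw [hh_def]
    simp only
    rw [suppCutoff_eq_one hR hy.le, sub_self, zero_smul]
  obtain ⟨hint, hderiv, hbound⟩ := hasFDerivAt_biotSavart_far hK hhc hh2 hR hvan
  -- linearity of the Biot–Savart integral near `x₀`
  have hEq : v =ᶠ[𝓝 x₀] fun x => biotSavart f x + biotSavart h x := by
    filter_upwards [Metric.ball_mem_nhds x₀ (half_pos hR)] with x hx
    rw [mem_ball, dist_eq_norm] at hx
    have hfi : Integrable fun y => biotSavartKernel (x - y) (f y) :=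
      integrable_biotSavartKernel_sub_apply_of_hasCompactSupport hfcont hfc x
    have hhi : Integrable fun y => biotSavartKernel (x - y) (h y) := hint x hx
    have hsum : biotSavart f x + biotSavart h x =
        ∫ y, (biotSavartKernel (x - y) (f y) + biotSavartKernel (x - y) (h y)) := by
      unfold biotSavart
      rw [integral_add hfi hhi]
    rw [hsum, ← congrFun hrep x]
    unfold biotSavart
    refine integral_congr_ae (Eventually.of_forall fun y => ?_)
    show biotSavartKernel (x - y) (curl v y) = biotSavartKernel (x - y) (f y) + biotSavartKernel (x - y) (h y)
    rw [← biotSavartCLM_apply, ← biotSavartCLM_apply, ← biotSavartCLM_apply, ← map_add, hfh]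
  -- the derivative of `v` at `x₀`
  have hDf : HasFDerivAt (biotSavart f) (fderiv ℝ (biotSavart f) x₀) x₀ :=
    (((contDiff_biotSavart one_pos hHolder hfc).differentiable one_ne_zero) x₀).hasFDerivAt
  have hDv : HasFDerivAt v
      (fderiv ℝ (biotSavart f) x₀ + ∫ y, (fderiv ℝ biotSavartCLM (x₀ - y)).flip (h y)) x₀ :=
    (hDf.add hderiv).congr_of_eventuallyEq hEq
  rw [hDv.fderiv, _root_.add_apply, inner_add_right]
  -- collect
  have h1 : ⟪e, fderiv ℝ (biotSavart f) x₀ e⟫ ≤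
      A * ∫ y in ball x₀ (2 * R), ‖curl v y - ⟪curl v y, e⟫ • e‖ * (‖x₀ - y‖ ^ 3)⁻¹ :=
    (le_abs_self _).trans hnear
  have h2 : ⟪e, (∫ y, (fderiv ℝ biotSavartCLM (x₀ - y)).flip (h y)) e⟫ ≤
      ‖∫ y, (fderiv ℝ biotSavartCLM (x₀ - y)).flip (h y)‖ := by
    calc ⟪e, (∫ y, (fderiv ℝ biotSavartCLM (x₀ - y)).flip (h y)) e⟫
        ≤ ‖e‖ * ‖(∫ y, (fderiv ℝ biotSavartCLM (x₀ - y)).flip (h y)) e‖ := real_inner_le_norm _ _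
      _ ≤ ‖e‖ * (‖∫ y, (fderiv ℝ biotSavartCLM (x₀ - y)).flip (h y)‖ * ‖e‖) := by
          gcongr
          exact ContinuousLinearMap.le_opNorm _ _
      _ = ‖∫ y, (fderiv ℝ biotSavartCLM (x₀ - y)).flip (h y)‖ := by rw [he]; ring
  have h4 : ∫ y, ‖h y‖ * (ball (0 : EuclideanSpace ℝ (Fin 3)) R)ᶜ.indicator (fun z => (‖z‖ ^ 3)⁻¹) (x₀ - y) ≤
      ∫ y, ‖curl v y‖ * (ball (0 : EuclideanSpace ℝ (Fin 3)) R)ᶜ.indicator (fun z => (‖z‖ ^ 3)⁻¹) (x₀ - y) := by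
    refine integral_mono_of_nonneg (Eventually.of_forall fun y => ?_)
      (integrable_norm_mul_farCube hwc hw2 x₀ hR) (Eventually.of_forall fun y => ?_)
    · exact mul_nonneg (norm_nonneg _) (farKernel_nonneg 3 R _)
    · exact mul_le_mul_of_nonneg_right (hhle y) (farKernel_nonneg 3 R _)
  have h5 := mul_le_mul_of_nonneg_left h4 (by positivity : (0 : ℝ) ≤ 8 * A')
  linarith


/-! ### In the frame: near field to local coherence, far field to the enstrophy -/

/-- **Localised point depletion for the class.** There are universal `A, A' ≥ 0` such that for every classical
unforced solution in the frame, every `t ∈ [0,T)`, every `x` with `ω(x,t) ≠ 0` and every `R > 0`: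
`⟪ω,(∇u)ω⟫(x,t) ≤ |ω(x,t)|²·(A·∫_{B(x,2R)} |ω(y) − ⟪ω(y),ξ(x)⟫ξ(x)| |x−y|⁻³ dy + 8A'·(4π/(3R³))^{1/2}·(∫‖ω(t)‖²)^{1/2})`
— the far field costs only the enstrophy `‖ω(t)‖²_{L²}` (finite in the frame, and `L¹` in time by the energy
inequality), the near field only the coherence of directions within `2R` of the point. -/
theorem inner_stretching_le_local : ∃ A A' : ℝ, 0 ≤ A ∧ 0 ≤ A' ∧
    ∀ (ν T : ℝ) (u : ℝ → (EuclideanSpace ℝ (Fin 3)) → (EuclideanSpace ℝ (Fin 3)))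
      (p : ℝ → (EuclideanSpace ℝ (Fin 3)) → ℝ),
      IsClassicalNSSolutionOn (Ico 0 T) ν 0 u p →
      (∀ T'' < T, HasBoundedSobolevNormsOn (Icc 0 T'') u) →
      ∀ t ∈ Ico 0 T, ∀ x, curl (u t) x ≠ 0 → ∀ R : ℝ, 0 < R →
        Integrable (fun y => ‖curl (u t) y‖ ^ 2) ∧
        ⟪curl (u t) x, fderiv ℝ (u t) x (curl (u t) x)⟫ ≤ ‖curl (u t) x‖ ^ 2 *
          (A * (∫ y in ball x (2 * R), ‖curl (u t) y - ⟪curl (u t) y, vorticityDirection (curl (u t)) x⟫ •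
              vorticityDirection (curl (u t)) x‖ * (‖x - y‖ ^ 3)⁻¹) +
            8 * A' * ((4 * π / (3 * R ^ 3)) ^ (1 / (2 : ℝ)) * (∫ y, ‖curl (u t) y‖ ^ 2) ^ (1 / (2 : ℝ)))) := by
  obtain ⟨A, hA0, hdep⟩ := exists_abs_inner_fderiv_biotSavart_le
  obtain ⟨A', hK⟩ := exists_isC1SingularKernel_biotSavartCLM
  refine ⟨A, A', hA0, hK.nonneg, ?_⟩
  intro ν T u p hsol hreg t ht x₀ hx R hR
  -- slice data (as in `pointDepletion_holds`)
  have hv : ContDiff ℝ ∞ (u t) := hsol.contDiff_velocity ht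
  have hv2 : ContDiff ℝ 2 (u t) := hv.of_le (by norm_cast)
  have hdiv : VectorCalculus.IsDivFree (u t) := hsol.divFree t ht
  have hB : HasBoundedSobolevNormsOn (Icc 0 t) u := hreg t ht.2
  have htI : t ∈ Icc 0 t := ⟨ht.1, le_rfl⟩
  obtain ⟨C₀, hC₀⟩ := hB 0
  obtain ⟨C₁, hC₁⟩ := hB 1
  have hv2' : ∫⁻ y, ‖u t y‖ₑ ^ 2 < ⊤ := by
    have h' : ∫⁻ y, ‖u t y‖ₑ ^ 2 ≤ C₀ := by
      refine le_of_eq_of_le (lintegral_congr fun y => ?_) (hC₀ t htI)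
      rw [← ofReal_norm, ← ofReal_norm, norm_iteratedFDeriv_zero]
    exact lt_of_le_of_lt h' ENNReal.coe_lt_top
  have hω2' : ∫⁻ y, ‖curl (u t) y‖ₑ ^ 2 < ⊤ :=
    lt_of_le_of_lt ((lintegral_curl_sq_le (u t)).trans (mul_le_mul' le_rfl (hC₁ t htI)))
      (ENNReal.mul_lt_top ENNReal.ofReal_lt_top ENNReal.coe_lt_top)
  have hrep : biotSavart (curl (u t)) = u t :=
    biotSavart_curl_eq_self_of_lintegral_sq_lt_top hv2 hdiv hv2' hω2'
  have hω1 : ContDiff ℝ 1 (curl (u t)) := contDiff_curl (n := 1) (by exact hv2)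
  have hωc : Continuous (curl (u t)) := hω1.continuous
  have hω2i : Integrable fun y => ‖curl (u t) y‖ ^ 2 := integrable_sq_norm_of_lintegral_lt_top hωc hω2'
  have hG := integrable_depletionIntegrand hω1 hω2i x₀
  refine ⟨hω2i, ?_⟩
  have he : ‖vorticityDirection (curl (u t)) x₀‖ = 1 := norm_vorticityDirection _ hx
  have hpar : curl (u t) x₀ = ‖curl (u t) x₀‖ • vorticityDirection (curl (u t)) x₀ :=
    (VorticityDirectionDynamics.norm_smul_vorticityDirection _ _).symm
  have hloc := inner_fderiv_le_local_add_tail hA0 hdep hK hv2 hrep hω2i he hpar hG hR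
  have htail := integral_norm_mul_farCube_le hωc hω2i x₀ hR
  have hle : ⟪vorticityDirection (curl (u t)) x₀,
      fderiv ℝ (u t) x₀ (vorticityDirection (curl (u t)) x₀)⟫ ≤
      A * (∫ y in ball x₀ (2 * R), ‖curl (u t) y - ⟪curl (u t) y, vorticityDirection (curl (u t)) x₀⟫ •
          vorticityDirection (curl (u t)) x₀‖ * (‖x₀ - y‖ ^ 3)⁻¹) +
        8 * A' * ((4 * π / (3 * R ^ 3)) ^ (1 / (2 : ℝ)) * (∫ y, ‖curl (u t) y‖ ^ 2) ^ (1 / (2 : ℝ))) := by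
    have h8 : 0 ≤ 8 * A' := by have := hK.nonneg; positivity
    nlinarith [hloc, mul_le_mul_of_nonneg_left htail h8]
  calc ⟪curl (u t) x₀, fderiv ℝ (u t) x₀ (curl (u t) x₀)⟫
      = ‖curl (u t) x₀‖ ^ 2 * ⟪vorticityDirection (curl (u t)) x₀,
          fderiv ℝ (u t) x₀ (vorticityDirection (curl (u t)) x₀)⟫ := by
        conv_lhs => rw [hpar]
        rw [map_smul, real_inner_smul_left, real_inner_smul_right]
        ring
    _ ≤ _ := mul_le_mul_of_nonneg_left hle (sq_nonneg _)

end Summit.NavierStokesRegularity.NavierStokesRegularity.Theorems.ArgmaxDoors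

end
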